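import Summits.ResolutionOfSingularities.ResolutionOfSingularities.Theorems.HilbertSamuelEliminationSigmaMaxModificationsCorridor3WLadderMovingRows
import Summits.ResolutionOfSingularities.ResolutionOfSingularities.Theorems.HilbertSamuelEliminationSigmaMaxModificationsCorridor3WLadderLocalOracleBridge
import HarnessLib

/-!
# [OURS · L1 W4.2] THE §MD JOINS FOR AN ARBITRARY ORACLE CLASS `𝓞` («O-JOIN PORT»; crux chain w42, skeleton `w_ladder_local` v7)

OURS (cell `res-hironaka`, slot W4.2, crux `stmt-ResolutionOfSingularities-18506` / conjunct `-19249`; W4.2 DEAL «O-JOIN PORT»,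
res-L1-w42-plan-1 RULINGS v3.12-3 (N), hand res-D-pv-038; `--supports … --as helper`, counted 0). NOT statements of the manuscript
under review [claim: Hironaka2017, status: under-review] nor of [CossartJannsenSaito2020]; AI plumbing, weaker than expert review.
Every `theorem` below is PROVED; no definition is introduced.

## What

The joins of module `…Corridor3WLadderMovingRows` (§MD: exact-grade split, regime dichotomy, grade dichotomy, `WB3M_of_rows5`)
quantify over ALL functional admissible oracles (`MaxOriginNoMovingNearChainAt(Q)`).  Skeleton v7 (`w_ladder_local`, RESHAPE RULE
(L) fired by `…Corridor3WLadderLocalOracleBridge`, p513172) composes ROWS RELATIVE TO AN ORACLE CLASS `𝓞`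
(`IdeasL1Idea2R4.MaxOriginNoMovingNearChainAtQO 𝓞 p N Q G`, module `…Corridor3WLadderMovingIsoDefs`), with `𝓞 = OracleLocal` at the
core row and `nuMod_three_of_rowO_local` downstream.  This file ports the joins verbatim with the class hypothesis `(hO : 𝓞 R)`
threaded through (universe-polymorphic, any `N`/`Q` where the original allows it):

* `MaxOriginNoMovingNearChainAtQO.mono` — shrinking the grade;
* `atQO_of_cases` — a row at `Q₁`-origins and a row at `¬Q₁`-origins give the row at any `Q` (regime / pointedness dichotomies);
* `rowO_low_of_char_two` — port of `wlow3M_of_char_two`: the (F1)-regime rows and their complement give the exact low grades at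
  every origin;
* `rowO_low_of_exactGrades` — port of `maxOriginNoMovingNearChainAt_low_of_exactGrades`: with W-mono
  (`Helpers.ClosedOriginGeomDirDimNonincrease p N`) the grade `ē` is eventually constant along an infinite chain, so the exact grades
  `ē = e ≤ 2` give the grade `ē ≤ 2`;
* `rowO_all_of_low_top` — port of `maxOriginNoMovingNearChainAt_all_of_grades'` (the engine of `WB3M_of_rows`): the grade
  dichotomy at the eventually-constant grade;
* **`rowO_all_of_rows5`** — the HEADLINE: W-mono + the two exact-low-grade class rows + the pointed and the non-pointed top class
  rows give the class row at ALL origins and ALL grades (`QAll`, `fun _ => True`), the top half being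
  `atQO_all_of_pointed_nonpointed` (p513172);
* **`rowO_all_of_rowsM`** — the convenience form skeleton v7 calls: the three REGISTERED all-oracle rows `Wlow3CharM p`,
  `Wlow3TwoM p`, `Wtop3PointedM p` (restricted to the class by `atQO_of_atQ`) + the non-pointed top row IN CLASS FORM;
* sanity at the trivial class `𝓞 = ⊤`: `maxOriginNoMovingNearChainAt_of_rowO_top` / `rowO_of_maxOriginNoMovingNearChainAt`
  (the `QAll`-row of the class `⊤` IS the all-oracle row), `WB3M_of_rows5_via_rowO` — `WB3M` from the moving rows of `w_ladder`
  v5/v6 THROUGH the port (non-pointed top row in `⊤`-class form; the literal twin of `WB3M_of_rows5` is that theorem itself and is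
  not restated) and `rowO_top_nonpointed_of_wtop3NonpointedM` — i.e. the port is faithful to `WB3M_of_rows5`.

[cite: CossartJannsenSaito2020, Thm. 1.2 (p. 5), Rem. 6.29 (1), Thm. 3.10 (4), p. 107]
-/

set_option linter.dupNamespace false -- mandated namespace `…ResolutionOfSingularities.ResolutionOfSingularities…` of this single-conjunct summit

open CategoryTheory AlgebraicGeometry TopologicalSpace
open Summit.ResolutionOfSingularities.ResolutionOfSingularities.Theorems.CampaignW42
open Literature.AlgebraicGeometry.Resolution Literature.RingTheory.HilbertSamuel
open Literature.AlgebraicGeometry.CossartJannsenSaito2020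
open Summit.ResolutionOfSingularities.ResolutionOfSingularities.Theses.HilbertSamuelElimination
open Summit.ResolutionOfSingularities.ResolutionOfSingularities.Theorems.SigmaMaxModificationsCorridor3
open Summit.ResolutionOfSingularities.ResolutionOfSingularities.Theorems.SigmaMaxModificationsCorridor3.Moving
open Summit.ResolutionOfSingularities.ResolutionOfSingularities.Theorems.SigmaMaxModificationsCorridor3.Helpers
  (QPointed QCharRegime InScopeC ClosedOriginGeomDirDimNonincrease)

universe u

namespace Summit.ResolutionOfSingularities.ResolutionOfSingularities.Cruxes.SigmaMaxModifications.IdeasL1Idea2R4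

variable {𝓞 : (∀ S : Scheme.{u}, CentreSeq S → Prop) → Prop} {p N : ℕ}

/-! ## §1. Elementary manipulations of class rows -/

/-- Shrinking the grade: no moving `G`-chain ⇒ no moving `G'`-chain for `G' ≤ G` (class form of
`MaxOriginNoMovingNearChainAtQ.mono`). [folklore] -/
theorem MaxOriginNoMovingNearChainAtQO.mono {Q : ℕ → (ℕ → ℕ) → ∀ X : Scheme.{u}, X → Prop}
    {G G' : MarkedStage.{u} → Prop} (h : MaxOriginNoMovingNearChainAtQO 𝓞 p N Q G) (hGG' : ∀ s, G' s → G s) :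
    MaxOriginNoMovingNearChainAtQO 𝓞 p N Q G' := by
  intro R hF hA hO ν X _ x hx hq
  rintro ⟨c, h0, hstep, hG, hmov⟩
  exact h R hF hA hO ν X x hx hq ⟨c, h0, hstep, fun n => hGG' _ (hG n), hmov⟩

/-- Restricting the origins: a class row at `Q`-origins gives the class row at `Q'`-origins for `Q' ⇒ Q`. [folklore] -/
theorem MaxOriginNoMovingNearChainAtQO.of_imp {Q Q' : ℕ → (ℕ → ℕ) → ∀ X : Scheme.{u}, X → Prop}
    {G : MarkedStage.{u} → Prop} (h : MaxOriginNoMovingNearChainAtQO 𝓞 p N Q G)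
    (hQQ' : ∀ N ν (X : Scheme.{u}) (x : X), Q' N ν X x → Q N ν X x) :
    MaxOriginNoMovingNearChainAtQO 𝓞 p N Q' G :=
  fun R hF hA hO ν X _ x hx hq => h R hF hA hO ν X x hx (hQQ' N ν X x hq)

/-- DICHOTOMY OF ORIGINS: the class row at `Q₁`-origins and the class row at `¬Q₁`-origins give the class row at any `Q`
(class form of `maxOriginNoMovingNearChainAt_of_split`; used with `Q₁ = QCharRegime p` and `Q₁ = QPointed`). [folklore] -/
theorem atQO_of_cases (Q₁ : ℕ → (ℕ → ℕ) → ∀ X : Scheme.{u}, X → Prop) {Q : ℕ → (ℕ → ℕ) → ∀ X : Scheme.{u}, X → Prop}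
    {G : MarkedStage.{u} → Prop} (hQ : MaxOriginNoMovingNearChainAtQO 𝓞 p N Q₁ G)
    (hnQ : MaxOriginNoMovingNearChainAtQO 𝓞 p N (fun N ν X x => ¬ Q₁ N ν X x) G) :
    MaxOriginNoMovingNearChainAtQO 𝓞 p N Q G := by
  intro R hF hA hO ν X _ x hx _
  by_cases hq : Q₁ N ν X x
  · exact hQ R hF hA hO ν X x hx hq
  · exact hnQ R hF hA hO ν X x hx hq

/-! ## §2. The §MD joins, class form -/

/-- **REGIME JOIN, class form** (port of `wlow3M_of_char_two`): the exact low grades in the (F1) regime `QCharRegime p` and in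
its complement give the exact low grades at every origin (any `Q`). [folklore] -/
theorem rowO_low_of_char_two {Q : ℕ → (ℕ → ℕ) → ∀ X : Scheme.{u}, X → Prop}
    (hchar : ∀ e ≤ 2, MaxOriginNoMovingNearChainAtQO 𝓞 p 3 (QCharRegime p) fun s => s.geomDirDim = e)
    (htwo : ∀ e ≤ 2, MaxOriginNoMovingNearChainAtQO 𝓞 p 3 (fun N ν X x => ¬ QCharRegime p N ν X x)
      fun s => s.geomDirDim = e) :
    ∀ e ≤ 2, MaxOriginNoMovingNearChainAtQO 𝓞 p 3 Q fun s => s.geomDirDim = e :=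
  fun e he => atQO_of_cases (QCharRegime p) (hchar e he) (htwo e he)

/-- **THE EXACT-GRADE SPLIT, class form** (port of `maxOriginNoMovingNearChainAt_low_of_exactGrades`): with W-mono, `ē` is
eventually constant along an infinite chain and a tail of a moving chain is moving, so the exact low grades `ē = e`, `e ≤ 2`, give
the grade `ē ≤ 2`. [cite: CossartJannsenSaito2020, Thm. 3.10 (4)] -/
theorem rowO_low_of_exactGrades {Q : ℕ → (ℕ → ℕ) → ∀ X : Scheme.{u}, X → Prop}
    (hmono : ClosedOriginGeomDirDimNonincrease.{u} p N)
    (hlow : ∀ e ≤ 2, MaxOriginNoMovingNearChainAtQO 𝓞 p N Q fun s => s.geomDirDim = e) :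
    MaxOriginNoMovingNearChainAtQO 𝓞 p N Q fun s => s.geomDirDim ≤ 2 := by
  intro R hRf hRa hO ν X _ x hX hq
  rintro ⟨c, h0, hstep, hle, hmov⟩
  have hsc : ∀ n, InScopeC p R N ν (c n) := fun n =>
    ⟨X, inferInstance, x, hX, reaches_chain h0 hstep n⟩
  have hg : ∀ n, (c (n + 1)).geomDirDim ≤ (c n).geomDirDim := fun n =>
    hmono R hRf hRa ν (c n) (c (n + 1)) (hsc n) (hstep n)
  obtain ⟨n₀, hn₀⟩ := eventually_const_of_succ_le (g := fun n => (c n).geomDirDim) hg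
  exact hlow (c n₀).geomDirDim (hle n₀) R hRf hRa hO ν X x hX hq ⟨fun n => c (n₀ + n), reaches_chain h0 hstep n₀,
    fun n => hstep (n₀ + n), fun n => by
      show (c (n₀ + n)).geomDirDim = (c n₀).geomDirDim
      exact hn₀ n, io_shift hmov n₀⟩

/-- **THE GRADE DICHOTOMY, class form** (port of `maxOriginNoMovingNearChainAt_all_of_grades'`, the engine of `WB3M_of_rows`):
with W-mono, along an infinite chain either `ē ≤ 2` eventually or `ē ≥ 3` throughout, so the low row and the top row give the
row at all grades. [cite: CossartJannsenSaito2020, Thm. 3.10 (4)] -/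
theorem rowO_all_of_low_top {Q : ℕ → (ℕ → ℕ) → ∀ X : Scheme.{u}, X → Prop}
    (hmono : ClosedOriginGeomDirDimNonincrease.{u} p N)
    (hlow : MaxOriginNoMovingNearChainAtQO 𝓞 p N Q fun s => s.geomDirDim ≤ 2)
    (htop : MaxOriginNoMovingNearChainAtQO 𝓞 p N Q fun s => 3 ≤ s.geomDirDim) :
    MaxOriginNoMovingNearChainAtQO 𝓞 p N Q fun _ => True := by
  intro R hRf hRa hO ν X _ x hX hq
  rintro ⟨c, h0, hstep, -, hmov⟩
  have hscope : ∀ n, InScopeC p R N ν (c n) := fun n => ⟨X, ‹_›, x, hX, reaches_chain h0 hstep n⟩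
  rcases eventually_not_or_io (fun n => 3 ≤ (c n).geomDirDim) with ⟨n₀, hn₀⟩ | hio
  · refine hlow R hRf hRa hO ν X x hX hq ⟨fun n => c (n₀ + n), reaches_chain h0 hstep n₀, fun n => hstep (n₀ + n),
      fun n => ?_, io_shift hmov n₀⟩
    have := hn₀ (n₀ + n) (Nat.le_add_right _ _)
    show (c (n₀ + n)).geomDirDim ≤ 2
    omega
  · have hanti : ∀ n k, (c (n + k)).geomDirDim ≤ (c n).geomDirDim := by
      intro n k
      induction k with
      | zero => exact le_rfl
      | succ k ih => exact (hmono R hRf hRa ν (c (n + k)) (c (n + k + 1)) (hscope _) (hstep (n + k))).trans ih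
    refine htop R hRf hRa hO ν X x hX hq ⟨c, h0, hstep, fun n => ?_, hmov⟩
    obtain ⟨m, hnm, h3⟩ := hio n
    have := hanti n (m - n)
    rw [show n + (m - n) = m by omega] at this
    exact h3.trans this

/-- **HEADLINE — the class row at ALL origins and ALL grades from FIVE class rows** (class form of `WB3M_of_rows5` at one prime):
W-mono, the exact low grades in the (F1) regime and in its complement, the top grade at pointed and at non-pointed origins.
[cite: CossartJannsenSaito2020, Thm. 3.10 (4), Rem. 6.29 (1), p. 107] -/
theorem rowO_all_of_rows5 (hmono : ClosedOriginGeomDirDimNonincrease.{u} p 3)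
    (hchar : ∀ e ≤ 2, MaxOriginNoMovingNearChainAtQO 𝓞 p 3 (QCharRegime p) fun s => s.geomDirDim = e)
    (htwo : ∀ e ≤ 2, MaxOriginNoMovingNearChainAtQO 𝓞 p 3 (fun N ν X x => ¬ QCharRegime p N ν X x)
      fun s => s.geomDirDim = e)
    (hpt : MaxOriginNoMovingNearChainAtQO 𝓞 p 3 QPointed fun s => 3 ≤ s.geomDirDim)
    (hnpt : MaxOriginNoMovingNearChainAtQO 𝓞 p 3 QNonpointed fun s => 3 ≤ s.geomDirDim) :
    MaxOriginNoMovingNearChainAtQO 𝓞 p 3 QAll fun _ => True :=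
  rowO_all_of_low_top hmono (rowO_low_of_exactGrades hmono (rowO_low_of_char_two hchar htwo))
    (atQO_all_of_pointed_nonpointed hpt hnpt)

/-- **The form skeleton v7 calls**: the three REGISTERED (all-oracle) rows `Wlow3CharM p`, `Wlow3TwoM p`, `Wtop3PointedM p`
(restricted to the class by `atQO_of_atQ`) and the non-pointed top row IN CLASS FORM give the class row at all origins and all
grades. [cite: CossartJannsenSaito2020, Thm. 3.10 (4), Rem. 6.29 (1), p. 107] -/
theorem rowO_all_of_rowsM (hmono : ClosedOriginGeomDirDimNonincrease.{u} p 3) (hchar : Wlow3CharM.{u} p)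
    (htwo : Wlow3TwoM.{u} p) (hpt : Wtop3PointedM.{u} p)
    (hnpt : MaxOriginNoMovingNearChainAtQO 𝓞 p 3 QNonpointed fun s => 3 ≤ s.geomDirDim) :
    MaxOriginNoMovingNearChainAtQO 𝓞 p 3 QAll fun _ => True :=
  rowO_all_of_rows5 hmono (fun e he => atQO_of_atQ (hchar e he)) (fun e he => atQO_of_atQ (htwo e he))
    (atQO_of_atQ hpt) hnpt

/-! ## §3. Sanity at the trivial class: the port is faithful to `WB3M_of_rows5` -/

/-- At the trivial class `𝓞 = ⊤`, the `QAll`-row IS the all-oracle row. [folklore] -/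
theorem maxOriginNoMovingNearChainAt_of_rowO_top {G : MarkedStage.{u} → Prop}
    (h : MaxOriginNoMovingNearChainAtQO (fun _ => True) p N QAll G) : MaxOriginNoMovingNearChainAt.{u} p N G :=
  fun R hRf hRa ν X _ x hX => h R hRf hRa trivial ν X x hX trivial

/-- Conversely the all-oracle row gives the `QAll`-row of every class. [folklore] -/
theorem rowO_of_maxOriginNoMovingNearChainAt {G : MarkedStage.{u} → Prop} (h : MaxOriginNoMovingNearChainAt.{u} p N G)
    {Q : ℕ → (ℕ → ℕ) → ∀ X : Scheme.{u}, X → Prop} : MaxOriginNoMovingNearChainAtQO 𝓞 p N Q G :=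
  fun R hRf hRa _ ν X _ x hX _ => h R hRf hRa ν X x hX

/-- **`WB3M` FROM THE MOVING ROWS THROUGH THE PORT, trivial class** — the hypotheses of `WB3M_of_rows5` with the non-pointed top
row asked only in `⊤`-CLASS form (the all-oracle stub `Wtop3NonpointedM p` gives it by `atQO_of_atQ`); the literal twin of
`WB3M_of_rows5` through the port type-checks as `fun … hnpt => WB3M_of_rows5_via_rowO … fun p hp => atQO_of_atQ (hnpt p hp)` and is
not restated (it IS `WB3M_of_rows5`). So the port is faithful. [folklore] -/
theorem WB3M_of_rows5_via_rowO (hmono : ∀ p : ℕ, p.Prime → ClosedOriginGeomDirDimNonincrease.{0} p 3)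
    (hchar : ∀ p : ℕ, p.Prime → Wlow3CharM.{0} p) (htwo : ∀ p : ℕ, p.Prime → Wlow3TwoM.{0} p)
    (hpt : ∀ p : ℕ, p.Prime → Wtop3PointedM.{0} p)
    (hnpt : ∀ p : ℕ, p.Prime →
      MaxOriginNoMovingNearChainAtQO.{0} (fun _ => True) p 3 QNonpointed fun s => 3 ≤ s.geomDirDim) : WB3M :=
  fun p hp => maxOriginNoMovingNearChainAt_of_rowO_top
    (rowO_all_of_rowsM (hmono p hp) (hchar p hp) (htwo p hp) (hpt p hp) (hnpt p hp))

/-- … and the registered all-oracle stub `Wtop3NonpointedM p` feeds it (one line; kept as the check that the `⊤`-class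
non-pointed row is exactly what v6's `stub_Wtop3M_nonpointed` supplied). [folklore] -/
theorem rowO_top_nonpointed_of_wtop3NonpointedM (h : Wtop3NonpointedM.{u} p) :
    MaxOriginNoMovingNearChainAtQO.{u} (fun _ => True) p 3 QNonpointed fun s => 3 ≤ s.geomDirDim :=
  atQO_of_atQ h

end Summit.ResolutionOfSingularities.ResolutionOfSingularities.Cruxes.SigmaMaxModifications.IdeasL1Idea2R4
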